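import Mathlib
import HarnessLib
import HarnessLib.Audit
import Summits.CriticalPhenomena.Statement
import Literature.Probability.RandomPlanarGeometry.ChordalCurveFamily
import Summits.CriticalPhenomena.SAWScalingLimit.Theorems.SAWPoissonBanksLSWSimpleRestrictionIsSLE
import HarnessLib.Audit.Status.Attr

/-!
Route: SAWDeterminantalDiagonal

DORMANT since 2026-08-25T08:04:02Z (reconciler: no traction for 7.5 d (last activity item-evidence-added at 2026-08-17T19:05:19Z); parked, not closed — `ledger route dormant route-CriticalPhenomena-SAWDeterminantalDiagonal --off` to rea) — unstaffed, not closed; items shared with open routes are served there. `ledger route dormant <id> --off` reactivates.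

# Route SAWDeterminantalDiagonal — charge-matched LERW and Kasteleyn dressings give a
restriction-neutral c=0 diagonal ending at the SAW

It suffices to show X = (DW) ∧ (U) [card determinantal-square-c0-diagonal]. The card puts the three
free planar path laws on ONE space of
simple lattice paths η : a → b of D_δ — LERW ∝ 4^-|η| det(G_D|_η) = 4^-|η| e^(m_D(η)) (κ=2, c=−2),
double-dimer path ∝ pm(D∖η)² =
pm(D)²·|det K_D⁻¹|_η| (Jacobi × Heilmann–Lieb; κ=4, c=+1), SAW ∝ x_c^|η|·1 (c=0) — and dresses the
SAW by both determinants,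
W_(s,u)(η) ∝ x^|η| e^(s·m_D(η)) (pm(D∖η)/pm(D))^(2u). Log restriction defects are EXACTLY linear in
(s,u) with continuum slopes +1 and −1/2
(Lawler's boundary-perturbation rule e^(−(c/2)·m), LTF-normalised loop measure), so on the diagonal
u = 2s the macroscopic defect cancels:
positive weights, simple paths, c = 0, asymptotically exact two-sided restriction, and LSW03
identifies every conformally covariant limit as
SLE_8/3 with no exponent computed. (DW): the far corner s = 1/2 — the DISCREPANCY WALK W(η) ∝ x^|η|
e^(m_D(η)/2) pm⋆(A_δ∖η)²
(= x^|η|·Z^DD/Z^GFF of the slit domain; A_δ the even-block dimer arena of D_δ, pm⋆ = product over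
connected components of the number of
dimer covers, an unmatchable pocket counting 1) — converges, at some fugacity x and for every
Dobrushin domain and endpoint approximation,
to chordal SLE_8/3; (U): diagonal universality carries this limit down
the line u = 2s to s = 0, which is SAW.law verbatim.
Lean: `Target` = `(∃ x > 0, ∀ D a b, SAW.IsEndpointApprox D a b → ConvergesInLawToSLE (8/3) D curve
(discrepancyLaw D δ a b x)) ∧ DiagonalUniversality` (decls of this route file; the discrepancy law
is inlined by `let` — full one-line terms in the items below, all elaborated, and `Assembly` PROVED,
in Sketch.lean)

## Assembly
PROVED sorry-free in Sketch.lean (`assembly_holds : Assembly`, axioms propext/choice/Quot.sound):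
DiscrepancyConfCov gives x, P with
(chordal, lim, conf); RestrictionOfDiagLimit fed with NeutralRestriction gives P.IsRestriction;
DiscrepancySimple gives the simple-curve
clause; LSWSimpleRestrictionIsSLE yields IsSLELaw (8/3) D (P D) = law of an SLE_8/3 random curve Γ
(P D = preWienerMeasure.map Γ);
integral_map converts TendstoLaw … id (P D) into TendstoLaw … Γ preWienerMeasure, measurability on
SAW.DomainSAW is by the discrete
σ-algebra, hence ConvergesInLawToSLE (8/3) for the discrepancy walk in every (D; a_δ, b_δ);
DiagonalUniversality at x turns this into the
conjunct SAWScalingLimit (definitionally the ∀-statement for SAW.law).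

Rationale: WHY THIS LINE. Mechanism (card determinantal-square-c0-diagonal): two exact Gaussian structures on
ℤ² — the Dirichlet Green function Δ⁻¹ (harmonic; LERW
= its path determinant, KozdronLawler2007 §6, Lawler2018 Prop. 5.2) and the inverse Kasteleyn matrix
K⁻¹ = discrete ∂̄⁻¹ (discrete-holomorphic
on bipartite ℤ², Kenyon2000, Kenyon2014; double-dimer path = its path determinant by Jacobi's
complementary-minor theorem applied to
HeilmannLieb1972's path identity) — dress the self-avoiding path with central charges −2s and +u;
the restriction-defect bookkeeping of
LawlerSchrammWerner2003Restriction §7 / Lawler2009 (defect slope −c/2 per dressing,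
LawlerTrujilloferreras2006 normalisation) makes the
diagonal u = 2s restriction-NEUTRAL, so identification is free (tree fact
Literature.Probability.RandomPlanarGeometry.LawlerSchrammWerner2003,
shared item LSWSimpleRestrictionIsSLE) and the programme is: asymptotic restriction in law
(NeutralRestriction), conformal covariance of ONE
new model where both free-field toolboxes act (DiscrepancyConfCov), simplicity (DiscrepancySimple),
universality along the neutral line
(DiagonalUniversality). Imported areas: dimer/Kasteleyn theory and limit shapes (Kenyon2000,
Kenyon2001, CohnKenyonPropp2001,
KenyonWilson2011, Dubedat2018, BasokChelkak2021), loop measures/loop soups (LawlerWerner2004,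
LawlerTrujilloferreras2006, Lawler2009),
conformal restriction (LSW03), CFT boundary anomalies of dimers (IzmailianEtAl2005,
PriezzhevRuelle2008) as the named risk. Versus prior
routes: SAWChargeContinuation moves along the u = 0 EDGE where κ(s) runs 2 → 8/3 and must continue
analytically in the charge; here κ is
constant on the diagonal and nothing is continued; SAWConfRestriction/SAWParafermion need an
observable for the SAW itself (barrier
NienhuisWeightsExcludeVertexSAW), here the observable problem is posed for a dressed model carrying
exact ∂̄-structure; the negatives index
(all-δ Tight, stmt-0772) is avoided — no tightness item, convergence is along 𝓝[>]0. New in the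
route beyond the card: neutrality is stated
IN LAW (typical rough slits are mesoscopically flat for the dimer height function; deterministic
staircase slits freeze their
neighbourhood, CohnKenyonPropp2001, so a slit-uniform statement would be false for the wrong reason)
and the dimer factor lives on a
parity-safe even-block arena and is taken componentwise (unmatchable pockets count 1: weights never
vanish, the parity of the two
macroscopic sides self-selects), so that s = 0 is SAW.law on the nose and no colour condition on
endpoints enters.

RANKED CRUXES. #0 Target (target) — X = (DW) ∧ (U): for some fugacity x > 0 the discrepancy walk
(weights x^|γ| · exp(m(γ)/2) · pm⋆(A_δ ∖ γ)² on SAW.DomainSAW, normalised; m = rooted random-walk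
loop mass (4^-n/n) of the loops of D_δ meeting γ; A_δ = sites of D_δ whose aligned 2×2 block lies in
D_δ with its four sides; pm⋆ = product over the connected components of the sub-graph of D_δ induced
on A_δ ∖ γ of the number of their perfect matchings, unmatchable components counting 1) converges in
law to chordal SLE_8/3 for every Dobrushin domain and endpoint approximation, AND this convergence
at any fugacity implies the same for SAW.law (the s = 0 end of the diagonal). (why it might fail: X
asserts SLE_8/3 for a NEW lattice model at an unknown fugacity plus a universality transfer along a
line of non-local dressings; either half can fail (net charge ≠ 0 on the chosen line;
even-block/parity artefacts; approximation-dependent limits refute the conjunct as typed).)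
[LawlerSchrammWerner2004SAW, LawlerSchrammWerner2003Restriction, KozdronLawler2007, Kenyon2014]
#2 NeutralRestriction (crux) — (card D2, in law) asymptotically exact two-sided restriction of the
discrepancy walk on the lattice: for every x > 0, every pair of Dobrushin domains D′ ⊆ D with the
same marked points and every endpoint approximation valid for both, the D-law conditioned on the
walk using only edges of D′_δ and the D′-law have asymptotically equal expectations of every bounded
continuous functional of the curve (δ → 0⁺). Content at criticality and for hull subdomains: the
neutral defect N(η) = Δ_G(η) + 2Δ_K(η) (Δ_G = m_D − m_D′ → +m^BL(γ; D∖D′), 2Δ_K = 4·[log pm-ratio] →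
−m^BL + const) concentrates at a constant under the D′-law; tangential D′: endpoint locality;
off-critical x: both sides degenerate alike. [difficulty: open-problem] (why it might fail: Slit,
non-Temperleyan dimer asymptotics are boundary-condition dependent (IzmailianEtAl2005: c_eff = −2 vs
1; frozen zones along near-diagonal slit stretches, CohnKenyonPropp2001): the η-dependent slope of
Δ_K may be r ≠ −1/2 (line u = s/|r|: restate) or have no limit (fatal).)
[LawlerSchrammWerner2003Restriction, Lawler2009, LawlerTrujilloferreras2006, Kenyon2014, Kenyon2000,
IzmailianEtAl2005, CohnKenyonPropp2001, KozdronLawler2007]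
#3 DiscrepancyConfCov (crux) — (card D3) existence and conformal covariance of the scaling limit of
the discrepancy walk at ONE fugacity: there are x > 0 and a chordal family P
(ChordalFamily.IsChordal) such that for every Dobrushin domain and endpoint approximation the
discrepancy-walk laws pushed to CurveClass ℂ converge weakly to P D, and P is conformally covariant
(ChordalFamily.IsConformallyCovariant). Intended engine: a martingale observable built from the two
Gaussian structures (Kasteleyn-side fermionic observable dressed by the Green-function ratio) plus
Kemppainen–Smirnov precompactness, tightness being helped by the LERW-side Green-function bounds at
s = 1/2. [difficulty: open-problem] (why it might fail: No exact observable: e^(m/2)·pm² has no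
closed resummation over paths (#P-hardness), K⁻¹'s holomorphicity acts on the dressing only;
covariance incl. ℤ² rotations for ALL endpoint approximations may be as hard as for the SAW; the
parity-constrained arena may leave lattice artefacts.) [LawlerSchrammWerner2004SAW, Kenyon2000,
Kenyon2014, BasokChelkak2021, Dubedat2018, KennedyLawler2013, KemppainenSmirnov2017]
#4 DiagonalUniversality (crux) — (card D4) universality along the neutral diagonal u = 2s from (1/2,
1) to (0, 0): for every x > 0, if the discrepancy walk at fugacity x converges in law to chordal
SLE_8/3 for every Dobrushin domain and endpoint approximation, then so does the critical SAW law
SAW.law (weights x_c^|γ|, the s = 0 member of the family, verbatim). Intended mechanism: a critical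
curve x_c(s) and the line integral of score covariances Cov_s(f∘curve, m + 4·log pm + (log x_c)′|γ|)
over s ∈ [0, 1/2] tending to 0 — irrelevance of a charge-NEUTRAL dressing. [difficulty:
open-problem] (why it might fail: The residual dressing between s = 1/2 and 0 is non-local and
scale-invariant (only its D-dependence cancels): irrelevance of a charge-neutral marginal
perturbation has no precedent; x_c(s) must stay critical all along; the matchable-complement
constraint is a global parity conditioning.) [KozdronLawler2007, KennedyLawler2013,
LawlerSchrammWerner2004SAW, LawlerSchrammWerner2003Restriction]
#5 DiscrepancySimple (crux) — (card D5) every chordal family that is the weak limit of the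
discrepancy-walk laws at some fugacity, is conformally covariant and has the two-sided restriction
property, is carried in every Dobrushin domain by simple curves meeting ∂D only at the two marked
points (no macroscopic pinching, no boundary crawling); by LSW03 Prop. 3.3 this is the statement
that the restriction exponent of the limit is exactly 5/8. [deps: NeutralRestriction,
DiscrepancyConfCov] [difficulty: open-problem] (why it might fail: A covariant restriction-exact
limit is P_α for some α ≥ 5/8 (LSW03 Prop 3.3) and only α = 5/8 is simple; weak limits of simple
polylines can pinch (α > 5/8 = SLE_8/3 plus Brownian bubbles), so a no-pinching/no-crawling estimate
for the discrepancy walk is needed and none is in print.) [LawlerSchrammWerner2003Restriction,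
LawlerSchrammWerner2004SAW, KennedyLawler2013]
#9 RestrictionOfDiagLimit (support) — glue (passage to the limit): NeutralRestriction implies that
every chordal, conformally covariant family arising as the weak limit of the discrepancy-walk laws
at a fugacity x > 0 has the restriction property ChordalFamily.IsRestriction — portmanteau on the
closed events range ⊆ cl D′, the null-touching of ∂(D∖D′) obtained from monotonicity in continuously
shrinking hull families plus weak continuity of D′ ↦ P D′ (conformal covariance), and the trivial
case P D(range ⊆ cl D′) = 0. [difficulty: L] [LawlerSchrammWerner2004SAW,
LawlerSchrammWerner2003Restriction, BillingsleyCPM1999]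
#9 DiscrepancyNondegenerate (support) — the discrepancy walk is eventually a probability law: for
every x > 0, Dobrushin domain and endpoint approximation, for all small δ > 0 the normalised law has
mass 1 — every weight is positive (the componentwise dimer factor is ≥ 1, e^(m/2) > 0) and there are
finitely many SAWs of D_δ, at least one by IsEndpointApprox.reachable; the lattice sanity half of
(lim) in DiscrepancyConfCov. [difficulty: provable-now] [CohnKenyonPropp2001, Kenyon2000,
HeilmannLieb1972]
#9 LSWSimpleRestrictionIsSLE (support) — (shared with SAWPoissonBanks, stmt-CriticalPhenomena-3017;
= tree fact Literature.Probability.RandomPlanarGeometry.LawlerSchrammWerner2003 with the named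
predicates unfolded) a chordal family that is conformally covariant, restriction-exact and carried
by simple curves meeting ∂D only at the marked points is, in every Dobrushin domain, the chordal
SLE_8/3 law (LSW03 p.5 result 2 = Prop 3.3 + Thm 6.1 + Thm 7.3 + Cor 8.6, transposed). [difficulty:
provable-now] [LawlerSchrammWerner2003Restriction, RohdeSchramm2005, Lawler2005]
#9 AssemblyTarget (support) — Target → SAWScalingLimit (pure logic: instantiate (U) at the fugacity
of (DW); `assemblyTarget_holds` in Sketch.lean). [difficulty: provable-now]
[LawlerSchrammWerner2004SAW]

TWO-LAYER PLAN. Foreseen glued splits (none filed now; k ≤ 3, depth 1): NeutralRestriction ⇐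
FarFieldSlopes (in D′-law probability, for hull subdomains:
Δ_G(η) → m^BL(γ; D∖D′) [LTF/Beneš–Lawler–Viklund-type loop-measure convergence] and 2Δ_K(η) + Δ_G(η)
− C_δ → 0) → NoHugging (uniform
smallness of the mass of walks crawling along ∂(D∖D′)) → NeutralRestriction; DiscrepancyConfCov ⇐
EventualTightDiscrepancy (Aizenman–Burchard
/ KS Condition G2 via Green-function bounds at s = 1/2) → ObservableCovariance (a dressed Kasteleyn
observable Σ_η W(η)·K⁻¹_(D∖η)(tip, z) is an
asymptotically covariant martingale; identifies subsequential limits up to covariance) →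
DiscrepancyConfCov; DiagonalUniversality ⇐ CriticalCurve
(a fugacity curve x_c(s), s ∈ [0,1/2], with x_c(0) = SAW.criticalFugacity and tight laws) →
ScoreDecoupling (∫_0^1/2 Cov_s(f∘curve, score_s) ds
→ 0, cf. card universality-line-integral) → DiagonalUniversality; DiscrepancySimple ⇐
Brownian-domination no-pinching (card
brownian-domination-simple-limits, transposed to the dressed walk) → DiscrepancySimple.

KILL CRITERIA. ¬NeutralRestriction with a STABLE slope r = lim ΔΔ_K/ΔΔ_G ∉ {−1/2}, r < 0 (cheapest
falsifier (i)) ⇒ one restate on the rotated line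
u = s/|r| (weights e^(s·m)·pm^(2s/|r|), same decl names); no limit, r ≥ 0, or an in-law failure at
criticality ⇒ close
`refuted:NeutralRestriction` (the charge bookkeeping is dead; the Jacobi/Heilmann–Lieb identities
survive as stand-alone facts).
¬DiscrepancyConfCov by a lattice artefact of the even-block arena (e.g. failure of
rotation covariance in the limit) ⇒ close; by non-existence of a critical point ⇒ close.
¬DiagonalUniversality ⇒ close (the route's bet),
keeping (DW) as a stand-alone target for other lines. ¬DiscrepancySimple (pinching limit, α > 5/8) ⇒
the dressed walk is a DIFFERENT restriction
measure: close and hand the witness to the restriction-rigidity routes. ConfCovLimit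
(SAWConfRestriction r2) or any full proof of the
conjunct elsewhere moots the route (supersede); LSWSimpleRestrictionIsSLE refuted is impossible
short of an error in the tree fact.

NOT DECOMPOSED YET. The (s,u)-square off the working point (only s ∈ {0, 1/2} on u = 2s are typed);
the critical curve x_c(s) and the score-covariance calculus
(children of DiagonalUniversality); the Brownian-loop-measure form of the slopes (NeutralRestriction
is typed lattice-intrinsically, no m^BL
needed); tightness/Aizenman–Burchard for the discrepancy walk and the dressed Kasteleyn observable
(children of DiscrepancyConfCov); the
Jacobi/Heilmann–Lieb/Lawler determinantal identities e^m = det(G|_η), pm(D∖η)²/pm(D)² = |det K⁻¹|_η|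
(provable-now support, filed informally
after open); Temperleyan versus even-block arenas, boundary-monomer and colour-balanced-trace
variants of the dimer factor (restate reserve); the Kasteleyn-edge by-product W_(0,1/2)
(annealed alternating SAW in dominoes, predicted Ising class SLE₃) — a falsifier of the bookkeeping,
not an item; radial/whole-plane versions.

CHEAPEST FALSIFIER. (i) Exact linear algebra, minutes of kit (not run: hub compute-free): D = 2n×2n
square (n = 8…128), D′ = D minus
a k×k notch in the top side (k ≈ n/2, away from the mid-side marked points); two AXIS-PARALLEL slits
with the same endpoints, η₁ = middle row,
η₂ = η₁ plus a rectangular detour of height ≈ n/2 towards the notch. With Δ_G(η) = log[det Δ_(D∖η)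
det Δ_D′/(det Δ_D det Δ_(D′∖η))]
(Dirichlet Laplacians) and Δ_K(η) = 2 log[pm(A∖η) pm(A′)/(pm(A) pm(A′∖η))] (Kasteleyn Pfaffians),
form
ρ_n = [Δ_K(η₂) − Δ_K(η₁)]/[Δ_G(η₂) − Δ_G(η₁)] (differences kill η-independent boundary constants).
Prediction ρ_n → −1/2; a stable
negative r ≠ −1/2 restates the line (u = s/|r|); no limit or r ≥ 0 kills NeutralRestriction. No
staircase slits (frozen zones).
(ii) Metropolis of the discrepancy walk (rank-one determinant updates, boxes 64²–256²): dimension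
4/3, P_D(·|⊂D′) ≈ P_D′.
(iii) Kasteleyn-edge model x^|η| pm(A∖η): Ising dimension 11/8, no SAW input. By hand here: LSW03 λ₂
= 2, λ₄ = −1 and
Lawler2009's e^((c/2)m) give slopes +1, −1/2; Temperleyan doubles COLLAPSE the Kasteleyn corner (pm
= det Δ_G|_(V∖η),
slope +2, no neutral line) — hence the even-block arena.

NUMBERS. c(κ) = (3κ−8)(6−κ)/(2κ): c(2) = −2, c(8/3) = 0, c(3) = 1/2, c(4) = 1; LSW03 §7.2 λ_κ =
(8−3κ)(6−κ)/(2κ) = −c. Defect slopes per unit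
dressing (LTF/random-walk normalisation, rooted loops 4^-n/n): Δ⁻¹-dressing e^(s·m): +1·s; Kasteleyn
dressing (pm(D∖η)/pm(D))^(2u): −u/2;
neutral line u = 2s; working point (s,u) = (1/2,1): W ∝ x^|η|·2^(|η|+1)·(det Δ_(D∖η)/det
Δ_D)^(1/2)·(pm ratio)² = x^|η|·Z^DD_(D∖η)/Z^GFF_(D∖η) up to
η-independent factors (det(I−P_V) = 4^-|V| det Δ_V). Restriction exponent forced by simplicity: 5/8
(LSW03 p.5). By-product (0,1/2): c = 1/2 ⇒
κ ∈ {3, 16/3}, simple ⇒ 3. x_c(0) = 1/μ(ℤ²) ∈ [1/2.7, 1/2.6]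
(LawlerSchrammWerner2004SAW_connectiveConstant_bounds); x at s = 1/2 unknown
(existential). Colour imbalance of a generic meshDomain ~ δ^(−1/2) (alternating lattice-point count)
— the reason for the even-block arena.
Items at open: 10 (4 cruxes).

DEFINITION REQUESTS. After open (for NeutralRestriction): (1) notion `perfectMatchingCount` (topic
Literature/Probability/LatticeModels): number of dimer covers
of the sub-graph of a simple graph on Site 2 induced on a vertex set, `Nat.card {M : (H.induce
V).Subgraph // M.IsPerfectMatching}`, with
pm ∅ = 1 and Kasteleyn's Pfaffian formula as API; (2) notions `blockArena`, `dimerFactor`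
(componentwise product, ≥ 1) and `discrepancyWalkLaw` (topic
Summits/CriticalPhenomena/SAWScalingLimit/Theorems): the inlined `let A`, `let pm`, `let L` of the
items (would shrink every signature to one line);
(3) `rwLoopMass` (rooted random-walk loop mass of the loops of a sub-graph of ℤ² meeting a vertex
set) — already requested by route
SAWChargeContinuation, same `let m` here. No cite facts needed beyond the tree fact
LawlerSchrammWerner2003 (ConformalRestriction.lean).

Novelty: Searches (2026-08-15): `lit search --hybrid "double-dimer path Kasteleyn inverse determinant
self-avoiding walk restriction"` (12 local docs:
Madras–Slade, Lawler 1991/2005/2012, Lyons–Peres, Slade, Guttmann's polygon book — no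
double-dimer/SAW link); `lit search --source crossref
"double dimer path scaling limit SLE4 boundary monomers Kenyon Wilson"` (14: KenyonWilson2011
doi:10.37236/617, Kenyon2014
doi:10.1007/s00220-013-1881-0, PriezzhevRuelle2008, Kenyon–Wilson tripartite 10.37236/201); `lit
search --source crossref "logarithmic conformal
field theory boundary effects dimer model finite-size corrections"` (10: IzmailianEtAl2005,
Izmailian–Oganesyan–Hu 2003); `--source s2` and
`--source zbmath` variants (0 rows), `--source arxiv` (HTTP 429); `lit galaxy search "double-dimer"
--star all` (18 rows: Gorin's lozenge-tiling
book panama:420588967428143, de Tilière HDR, Kenyon–Sun–Wilson tori, Li arXiv:1309.0151 — none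
touching SAW or restriction); plus the card's
searches and the refuter novelty audit of the card (new-combination, 2026-08-15T07:49:59Z).
Nearest prior art found: KozdronLawler2007 §6 with KennedyLawler2013 §1.1 (the det(G)^s / λ-SAW
homotopy LERW ↔ SAW = the u = 0 edge; route
SAWChargeContinuation); LawlerSchrammWerner2003Restriction §7 + LawlerWerner2004 + Lawler2009
(defect slope = −c/2, additivity of
restriction exponents under independent dressings); Kenyon2014, KenyonWilson2011, Dubedat2018,
BasokChelkak2021 (determinantal double-dimer
technology, CLE₄/SLE₄  [refs: 10.37236/617, 10.1007/s00220-013-1881-0, 10.37236/201, 1309.0151, doi:10.37236/617, doi:10.1007/s00220-013-1881-0, KenyonWilson2011, Kenyon2014, PriezzhevRuelle2008, IzmailianEtAl2005, KozdronLawler2007, KennedyLawler2013, LawlerWerner2004, Lawler2009, Dubedat2018, BasokChelkak2021, HeilmannLieb1972]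

Barriers (technique_class: determinantal-dressing charge-matching restriction dimers): - technique_class: determinantal-dressing charge-matching restriction dimers
- Literature.Barriers.CriticalPhenomena.NienhuisWeightsExcludeVertexSAW: applies to the s = 0 corner
(no exact vertex relation for the uniform ℤ² observable) and is the reason to work at s = 1/2: the
Kasteleyn dressing carries exact ∂̄-structure on bipartite ℤ²; the plain SAW is reached by
DiagonalUniversality, not by an identity — evaded by design at the price of that crux.
- Literature.Barriers.CriticalPhenomena.ParafermionicHalfCauchyRiemann: not applicable — no
hexagonal vertex relations are used; the proposed observable is K⁻¹-based (full discrete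
Cauchy–Riemann on ℤ²) acting on the dressing only (conceded: only approximately a martingale).
- Literature.Barriers.CriticalPhenomena.GridSAWCountingSharpPComplete: respected — per-path weights
are determinants, no closed form or polynomial-time evaluation of a sum over SAWs is claimed; this
is exactly why DiscrepancyConfCov is a crux and not a computation.
- Literature.Barriers.CriticalPhenomena.SAWNotKineticallyGrown: not applicable — all models are
configurational (Gibbs weights on finished paths); LERW enters through its finished law e^m, never
through a growth rule.
- Literature.Barriers.CriticalPhenomena.SupercriticalSAWSpaceFilling: respected — every point of the
square is taken at its own critical fugacity (existential x in DiscrepancyConfCov, x_c at s = 0);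
NeutralRestriction is stated for all x because off-critical both sides degenerate alik

History (route lifecycle, newest last):
- 2026-08-15T16:14:32Z · rev 2: dropped stmt-CriticalPhenomena-8352 — hygiene: drop stmt-8352 — informal text is the single character 'x', an empty duplicate of DeterminantalIdentities (stmt-8350) created at open; flagged as such (planner-rbadge-CriticalPhenomena-SAWDeterminan-921f123a-g4-0)
- 2026-08-16T03:13:42Z · rev 5: dropped stmt-CriticalPhenomena-14139 — route-choice (a) target-unreachable: add glue support TargetFromCruxes : NeutralRestriction → DiscrepancyConfCov → DiagonalUniversality → DiscrepancySimple → LS (planner-rchoice-CriticalPhenomena-SAWDetermina-5ee72b65-0)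
- 2026-08-25T08:04:02Z · DORMANT — reconciler: no traction for 7.5 d (last activity item-evidence-added at 2026-08-17T19:05:19Z); parked, not closed — `ledger route dormant route-CriticalPhenomen (operator:999:3438185)

sub-problem: SAWScalingLimit · status: dormant · opened planner-plancard-CriticalPhenomena-SAWScaling-bcd846db-0 2026-08-15T12:35:52Z · rev 5 · ledger route-CriticalPhenomena-SAWDeterminantalDiagonal
GENERATED by the gate from the ledger (D-0016/17). Provers cite these decls: `theorem foo : Summit.CriticalPhenomena.SAWScalingLimit.Theses.SAWDeterminantalDiagonal.<Decl> := …` in Summits/CriticalPhenomena/SAWScalingLimit/Theorems/<Name>.lean.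
-/

namespace Summit.CriticalPhenomena.SAWScalingLimit.Theses.SAWDeterminantalDiagonal

open scoped BigOperators Topology Manifold Classical MeasureTheory ProbabilityTheory Matrix InnerProductSpace ComplexConjugate ContinuousMap
open Filter Set Function TopologicalSpace MeasureTheory

attribute [summit_statement] _root_.SAWScalingLimit

/-- item stmt-CriticalPhenomena-8238 · target · rank 0 · open · by planner
why it might fail: X = (∃x: DW → SLE_8/3 everywhere) ∧ U: conjunct 1 posits SLE_8/3 for a NEW non-local model at an unknown fugacity, no observable, no numerics (Kasteleyn slope −1/2 untested); U ≡ (∃x DW) → conjunct is empty unless DW holds; net charge ≠ 0 on u = 2s or an even-block parity artefact breaks X.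
sources: LawlerSchrammWerner2004SAW, LawlerSchrammWerner2003Restriction, KozdronLawler2007, Kenyon2014, IzmailianEtAl2005
[target] X = (DW) ∧ (U): for some fugacity x > 0 the discrepancy walk (weights x^|γ| · exp(m(γ)/2) ·
pm⋆(A_δ ∖ γ)² on SAW.DomainSAW, normalised; m = rooted random-walk loop mass (4^-n/n) of the loops
of D_δ meeting γ; A_δ = sites of D_δ whose aligned 2×2 block lies in D_δ with its four sides; pm⋆ =
product over the connected components of the sub-graph of D_δ induced on A_δ ∖ γ of the number of
their perfect matchings, unmatchable components counting 1) converges in law to chordal SLE_8/3 for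
every Dobrushin domain and endpoint approximation, AND this convergence at any fugacity implies the
same for SAW.law (the s = 0 end of the diagonal). -/
@[route_item "route-CriticalPhenomena-SAWDeterminantalDiagonal"]
def Target : Prop :=
  let pm : SimpleGraph (Literature.Probability.LatticeModels.Site 2) → Set (Literature.Probability.LatticeModels.Site 2) → ℕ := fun H V => ∏ᶠ C : (H.induce V).ConnectedComponent, max 1 (Nat.card {M : ((H.induce V).induce C.supp).Subgraph // M.IsPerfectMatching}); let m : SimpleGraph (Literature.Probability.LatticeModels.Site 2) → Set (Literature.Probability.LatticeModels.Site 2) → ℝ := fun H S => ∑' p : (Σ x : Literature.Probability.LatticeModels.Site 2, H.Walk x x), if 0 < p.2.length ∧ (∃ v ∈ p.2.support, v ∈ S) then (1 / 4 : ℝ) ^ p.2.length / (p.2.length : ℝ) else 0; let A : Set ℂ → ℝ → Set (Literature.Probability.LatticeModels.Site 2) := fun Ω δ => {x | ∀ y : Literature.Probability.LatticeModels.Site 2, (∀ i, y i - Int.emod (y i) 2 = x i - Int.emod (x i) 2) → y ∈ Literature.Probability.LatticeModels.meshDomain Ω δ ∧ ∀ z : Literature.Probability.LatticeModels.Site 2,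 (∀ i, z i - Int.emod (z i) 2 = x i - Int.emod (x i) 2) → (Literature.Probability.LatticeModels.zdGraph 2).Adj y z → (Literature.Probability.LatticeModels.discreteDomainGraph Ω δ).Adj y z}; let L : (Ω : Set ℂ) → (δ : ℝ) → (a b : Literature.Probability.LatticeModels.Site 2) → ℝ → MeasureTheory.Measure (Literature.Probability.RandomPlanarGeometry.SAW.DomainSAW Ω δ a b) := fun Ω δ a b x => let μ : MeasureTheory.Measure (Literature.Probability.RandomPlanarGeometry.SAW.DomainSAW Ω δ a b) := MeasureTheory.Measure.sum (fun γ => ENNReal.ofReal (x ^ γ.length * Real.exp (m (Literature.Probability.LatticeModels.discreteDomainGraph Ω δ) {v | v ∈ γ.walk.support} / 2) * (pm (Literature.Probability.LatticeModels.discreteDomainGraph Ω δ) (A Ω δ \ {v | v ∈ γ.walk.support}) : ℝ) ^ 2) • MeasureTheory.Measure.dirac γ); (μ Set.univ)⁻¹ • μ; (∃ x : ℝ, 0 < x ∧ ∀ (D : Literature.Probability.RandomPlanarGeometry.DobrushinDomain) (a b : ℝ → Literature.Probability.LatticeModels.Site 2), Literature.Probability.RandomPlanarGeometry.SAW.IsEndpointApprox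 D a b → Literature.Probability.RandomPlanarGeometry.ConvergesInLawToSLE ((8 : NNReal) / 3) D (fun δ (γ : Literature.Probability.RandomPlanarGeometry.SAW.DomainSAW D.carrier δ (a δ) (b δ)) => γ.curve) (fun δ => L D.carrier δ (a δ) (b δ) x)) ∧ (∀ x : ℝ, 0 < x → (∀ (D : Literature.Probability.RandomPlanarGeometry.DobrushinDomain) (a b : ℝ → Literature.Probability.LatticeModels.Site 2), Literature.Probability.RandomPlanarGeometry.SAW.IsEndpointApprox D a b → Literature.Probability.RandomPlanarGeometry.ConvergesInLawToSLE ((8 : NNReal) / 3) D (fun δ (γ : Literature.Probability.RandomPlanarGeometry.SAW.DomainSAW D.carrier δ (a δ) (b δ)) => γ.curve) (fun δ => L D.carrier δ (a δ) (b δ) x)) → ∀ (D : Literature.Probability.RandomPlanarGeometry.DobrushinDomain) (a b : ℝ → Literature.Probability.LatticeModels.Site 2), Literature.Probability.RandomPlanarGeometry.SAW.IsEndpointApprox D a b → Literature.Probability.RandomPlanarGeometry.ConvergesInLawToSLE ((8 : NNReal) / 3) D (fun δ (γ : Literature.Probability.RandomPlanarGeometry.SAW.DomainSAW D.carrier δ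 (a δ) (b δ)) => γ.curve) (fun δ => Literature.Probability.RandomPlanarGeometry.SAW.law D.carrier δ (a δ) (b δ)))

/-- item stmt-CriticalPhenomena-8245 · crux · rank 2 · open · by planner
why it might fail: Neutrality needs the Kasteleyn defect slope to be exactly −1/2 on rough non-Temperleyan slits: dimer finite-size terms depend on boundary conditions (IzmailianEtAl2005), staircase stretches freeze (CKP2001) ⇒ r ≠ −1/2 or no limit; ∀x>0 also covers the dense phase (DCKY2014), where limits may differ.
sources: LawlerSchrammWerner2003Restriction, Lawler2009, LawlerTrujilloferreras2006, Kenyon2000, Kenyon2014, IzmailianEtAl2005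
[crux] (card D2, in law) asymptotically exact two-sided restriction of the discrepancy walk on the
lattice: for every x > 0, every pair of Dobrushin domains D′ ⊆ D with the same marked points and
every endpoint approximation valid for both, the D-law conditioned on the walk using only edges of
D′_δ and the D′-law have asymptotically equal expectations of every bounded continuous functional of
the curve (δ → 0⁺). Content at criticality and for hull subdomains: the neutral defect N(η) = Δ_G(η)
+ 2Δ_K(η) (Δ_G = m_D − m_D′ → +m^BL(γ; D∖D′), 2Δ_K = 4·[log pm-ratio] → −m^BL + const) concentrates
at a constant under the D′-law; tangential D′: endpoint locality; off-critical x: both sides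
degenerate alike. [difficulty: open-problem] -/
@[route_item "route-CriticalPhenomena-SAWDeterminantalDiagonal", crux]
def NeutralRestriction : Prop :=
  let pm : SimpleGraph (Literature.Probability.LatticeModels.Site 2) → Set (Literature.Probability.LatticeModels.Site 2) → ℕ := fun H V => ∏ᶠ C : (H.induce V).ConnectedComponent, max 1 (Nat.card {M : ((H.induce V).induce C.supp).Subgraph // M.IsPerfectMatching}); let m : SimpleGraph (Literature.Probability.LatticeModels.Site 2) → Set (Literature.Probability.LatticeModels.Site 2) → ℝ := fun H S => ∑' p : (Σ x : Literature.Probability.LatticeModels.Site 2, H.Walk x x), if 0 < p.2.length ∧ (∃ v ∈ p.2.support, v ∈ S) then (1 / 4 : ℝ) ^ p.2.length / (p.2.length : ℝ) else 0; let A : Set ℂ → ℝ → Set (Literature.Probability.LatticeModels.Site 2) := fun Ω δ => {x | ∀ y : Literature.Probability.LatticeModels.Site 2, (∀ i, y i - Int.emod (y i) 2 = x i - Int.emod (x i) 2) → y ∈ Literature.Probability.LatticeModels.meshDomain Ω δ ∧ ∀ z : Literature.Probability.LatticeModels.Site 2, (∀ i, z i - Int.emod (z i) 2 = x i - Int.emod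 (x i) 2) → (Literature.Probability.LatticeModels.zdGraph 2).Adj y z → (Literature.Probability.LatticeModels.discreteDomainGraph Ω δ).Adj y z}; let L : (Ω : Set ℂ) → (δ : ℝ) → (a b : Literature.Probability.LatticeModels.Site 2) → ℝ → MeasureTheory.Measure (Literature.Probability.RandomPlanarGeometry.SAW.DomainSAW Ω δ a b) := fun Ω δ a b x => let μ : MeasureTheory.Measure (Literature.Probability.RandomPlanarGeometry.SAW.DomainSAW Ω δ a b) := MeasureTheory.Measure.sum (fun γ => ENNReal.ofReal (x ^ γ.length * Real.exp (m (Literature.Probability.LatticeModels.discreteDomainGraph Ω δ) {v | v ∈ γ.walk.support} / 2) * (pm (Literature.Probability.LatticeModels.discreteDomainGraph Ω δ) (A Ω δ \ {v | v ∈ γ.walk.support}) : ℝ) ^ 2) • MeasureTheory.Measure.dirac γ); (μ Set.univ)⁻¹ • μ; ∀ x : ℝ, 0 < x → ∀ (D D' : Literature.Probability.RandomPlanarGeometry.DobrushinDomain), D'.carrier ⊆ D.carrier → D'.pt 0 = D.pt 0 → D'.pt 1 = D.pt 1 → ∀ (a b : ℝ → Literature.Probability.LatticeModels.Site 2), Literature.Probability.RandomPlanarGeometry.SAW.IsEndpointApprox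 D a b → Literature.Probability.RandomPlanarGeometry.SAW.IsEndpointApprox D' a b → ∀ f : BoundedContinuousFunction (Literature.Probability.RandomPlanarGeometry.CurveClass ℂ) ℝ, Filter.Tendsto (fun δ => (∫ γ, f γ.curve ∂(ProbabilityTheory.cond (L D.carrier δ (a δ) (b δ) x) {γ | ∀ e ∈ γ.walk.darts, (Literature.Probability.LatticeModels.discreteDomainGraph D'.carrier δ).Adj e.fst e.snd})) - ∫ γ, f γ.curve ∂(L D'.carrier δ (a δ) (b δ) x)) (nhdsWithin 0 (Set.Ioi 0)) (nhds 0)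

/-- item stmt-CriticalPhenomena-8246 · crux · rank 3 · open · by planner
why it might fail: No exact observable: K⁻¹ is discrete-holomorphic in the dressing only, weighted SAW sums have no closed form (#P barrier GridSAWCountingSharpPComplete); a fugacity with a non-degenerate tight limit must exist; covariance incl. ℤ² rotations for every endpoint approximation; even-block anisotropy.
sources: LawlerSchrammWerner2004SAW, Kenyon2000, Kenyon2014, KemppainenSmirnov2017, BasokChelkak2021, Dubedat2018
[crux] (card D3) existence and conformal covariance of the scaling limit of the discrepancy walk at
ONE fugacity: there are x > 0 and a chordal family P (ChordalFamily.IsChordal) such that for every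
Dobrushin domain and endpoint approximation the discrepancy-walk laws pushed to CurveClass ℂ
converge weakly to P D, and P is conformally covariant (ChordalFamily.IsConformallyCovariant).
Intended engine: a martingale observable built from the two Gaussian structures (Kasteleyn-side
fermionic observable dressed by the Green-function ratio) plus Kemppainen–Smirnov precompactness,
tightness being helped by the LERW-side Green-function bounds at s = 1/2. [difficulty: open-problem] -/
@[route_item "route-CriticalPhenomena-SAWDeterminantalDiagonal", crux]
def DiscrepancyConfCov : Prop :=
  let pm : SimpleGraph (Literature.Probability.LatticeModels.Site 2) → Set (Literature.Probability.LatticeModels.Site 2) → ℕ := fun H V => ∏ᶠ C : (H.induce V).ConnectedComponent, max 1 (Nat.card {M : ((H.induce V).induce C.supp).Subgraph // M.IsPerfectMatching}); let m : SimpleGraph (Literature.Probability.LatticeModels.Site 2) → Set (Literature.Probability.LatticeModels.Site 2) → ℝ := fun H S => ∑' p : (Σ x : Literature.Probability.LatticeModels.Site 2, H.Walk x x), if 0 < p.2.length ∧ (∃ v ∈ p.2.support, v ∈ S) then (1 / 4 : ℝ) ^ p.2.length / (p.2.length : ℝ) else 0; let A : Set ℂ → ℝ → Set (Literature.Probability.LatticeModels.Site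 2) := fun Ω δ => {x | ∀ y : Literature.Probability.LatticeModels.Site 2, (∀ i, y i - Int.emod (y i) 2 = x i - Int.emod (x i) 2) → y ∈ Literature.Probability.LatticeModels.meshDomain Ω δ ∧ ∀ z : Literature.Probability.LatticeModels.Site 2, (∀ i, z i - Int.emod (z i) 2 = x i - Int.emod (x i) 2) → (Literature.Probability.LatticeModels.zdGraph 2).Adj y z → (Literature.Probability.LatticeModels.discreteDomainGraph Ω δ).Adj y z}; let L : (Ω : Set ℂ) → (δ : ℝ) → (a b : Literature.Probability.LatticeModels.Site 2) → ℝ → MeasureTheory.Measure (Literature.Probability.RandomPlanarGeometry.SAW.DomainSAW Ω δ a b) := fun Ω δ a b x => let μ : MeasureTheory.Measure (Literature.Probability.RandomPlanarGeometry.SAW.DomainSAW Ω δ a b) := MeasureTheory.Measure.sum (fun γ => ENNReal.ofReal (x ^ γ.length * Real.exp (m (Literature.Probability.LatticeModels.discreteDomainGraph Ω δ) {v | v ∈ γ.walk.support} / 2) * (pm (Literature.Probability.LatticeModels.discreteDomainGraph Ω δ) (A Ω δ \ {v | v ∈ γ.walk.support}) : ℝ) ^ 2) • MeasureTheory.Measure.dirac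 γ); (μ Set.univ)⁻¹ • μ; ∃ x : ℝ, 0 < x ∧ ∃ P : Literature.Probability.RandomPlanarGeometry.ChordalFamily, P.IsChordal ∧ (∀ (D : Literature.Probability.RandomPlanarGeometry.DobrushinDomain) (a b : ℝ → Literature.Probability.LatticeModels.Site 2), Literature.Probability.RandomPlanarGeometry.SAW.IsEndpointApprox D a b → Literature.Probability.RandomPlanarGeometry.TendstoLaw (fun δ (γ : Literature.Probability.RandomPlanarGeometry.SAW.DomainSAW D.carrier δ (a δ) (b δ)) => γ.curve) (fun δ => L D.carrier δ (a δ) (b δ) x) id (P D)) ∧ P.IsConformallyCovariant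

/-- item stmt-CriticalPhenomena-8247 · crux · rank 4 · open · by planner
why it might fail: ≡ (∃x, DW at x) → SAWScalingLimit: empty if no fugacity gives SLE_8/3, else as hard as the conjecture given one solved model; the residual dressing e^(s·m)·pm⋆^(4s), 0<s<1/2, is non-local and marginal (only its D-dependence cancels); x_c(s) must stay critical; no deformation-universality theorem.
sources: KozdronLawler2007, KennedyLawler2013, LawlerSchrammWerner2004SAW, LawlerSchrammWerner2003Restriction, HattoriOgoOtsuka2017
[crux] (card D4) universality along the neutral diagonal u = 2s from (1/2, 1) to (0, 0): for every x
> 0, if the discrepancy walk at fugacity x converges in law to chordal SLE_8/3 for every Dobrushin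
domain and endpoint approximation, then so does the critical SAW law SAW.law (weights x_c^|γ|, the s
= 0 member of the family, verbatim). Intended mechanism: a critical curve x_c(s) and the line
integral of score covariances Cov_s(f∘curve, m + 4·log pm + (log x_c)′|γ|) over s ∈ [0, 1/2] tending
to 0 — irrelevance of a charge-NEUTRAL dressing. [difficulty: open-problem] -/
@[route_item "route-CriticalPhenomena-SAWDeterminantalDiagonal", crux]
def DiagonalUniversality : Prop :=
  let pm : SimpleGraph (Literature.Probability.LatticeModels.Site 2) → Set (Literature.Probability.LatticeModels.Site 2) → ℕ := fun H V => ∏ᶠ C : (H.induce V).ConnectedComponent, max 1 (Nat.card {M : ((H.induce V).induce C.supp).Subgraph // M.IsPerfectMatching}); let m : SimpleGraph (Literature.Probability.LatticeModels.Site 2) → Set (Literature.Probability.LatticeModels.Site 2) → ℝ := fun H S => ∑' p : (Σ x : Literature.Probability.LatticeModels.Site 2, H.Walk x x), if 0 < p.2.length ∧ (∃ v ∈ p.2.support, v ∈ S) then (1 / 4 : ℝ) ^ p.2.length / (p.2.length : ℝ) else 0; let A : Set ℂ → ℝ → Set (Literature.Probability.LatticeModels.Site 2) := fun Ω δ =>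 {x | ∀ y : Literature.Probability.LatticeModels.Site 2, (∀ i, y i - Int.emod (y i) 2 = x i - Int.emod (x i) 2) → y ∈ Literature.Probability.LatticeModels.meshDomain Ω δ ∧ ∀ z : Literature.Probability.LatticeModels.Site 2, (∀ i, z i - Int.emod (z i) 2 = x i - Int.emod (x i) 2) → (Literature.Probability.LatticeModels.zdGraph 2).Adj y z → (Literature.Probability.LatticeModels.discreteDomainGraph Ω δ).Adj y z}; let L : (Ω : Set ℂ) → (δ : ℝ) → (a b : Literature.Probability.LatticeModels.Site 2) → ℝ → MeasureTheory.Measure (Literature.Probability.RandomPlanarGeometry.SAW.DomainSAW Ω δ a b) := fun Ω δ a b x => let μ : MeasureTheory.Measure (Literature.Probability.RandomPlanarGeometry.SAW.DomainSAW Ω δ a b) := MeasureTheory.Measure.sum (fun γ => ENNReal.ofReal (x ^ γ.length * Real.exp (m (Literature.Probability.LatticeModels.discreteDomainGraph Ω δ) {v | v ∈ γ.walk.support} / 2) * (pm (Literature.Probability.LatticeModels.discreteDomainGraph Ω δ) (A Ω δ \ {v | v ∈ γ.walk.support}) : ℝ) ^ 2) • MeasureTheory.Measure.dirac γ); (μ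 Set.univ)⁻¹ • μ; ∀ x : ℝ, 0 < x → (∀ (D : Literature.Probability.RandomPlanarGeometry.DobrushinDomain) (a b : ℝ → Literature.Probability.LatticeModels.Site 2), Literature.Probability.RandomPlanarGeometry.SAW.IsEndpointApprox D a b → Literature.Probability.RandomPlanarGeometry.ConvergesInLawToSLE ((8 : NNReal) / 3) D (fun δ (γ : Literature.Probability.RandomPlanarGeometry.SAW.DomainSAW D.carrier δ (a δ) (b δ)) => γ.curve) (fun δ => L D.carrier δ (a δ) (b δ) x)) → ∀ (D : Literature.Probability.RandomPlanarGeometry.DobrushinDomain) (a b : ℝ → Literature.Probability.LatticeModels.Site 2), Literature.Probability.RandomPlanarGeometry.SAW.IsEndpointApprox D a b → Literature.Probability.RandomPlanarGeometry.ConvergesInLawToSLE ((8 : NNReal) / 3) D (fun δ (γ : Literature.Probability.RandomPlanarGeometry.SAW.DomainSAW D.carrier δ (a δ) (b δ)) => γ.curve) (fun δ => Literature.Probability.RandomPlanarGeometry.SAW.law D.carrier δ (a δ) (b δ))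

/-- item stmt-CriticalPhenomena-8248 · crux · rank 5 · open · by planner
why it might fail: Chordal + covariant + restriction only gives P_α, α ≥ 5/8, simple iff α = 5/8 (LSW03; tree eq_five_eighths_of_simple_holds); weak limits of simple polylines can pinch or crawl on ∂D, and excursion-like α > 5/8 curve laws ARE restriction-exact: needs a model-specific no-pinching bound; none in print.
sources: LawlerSchrammWerner2003Restriction, LawlerSchrammWerner2004SAW, KennedyLawler2013, arXiv:math/0209343, Literature.Probability.RandomPlanarGeometry.IsRestrictionMeasure.eq_five_eighths_of_simple_holds, Literature.Probability.RandomPlanarGeometry.IsRestrictionMeasure.ae_interior_nonempty_of_gt_five_eighths_holds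
[crux] (card D5) every chordal family that is the weak limit of the discrepancy-walk laws at some
fugacity, is conformally covariant and has the two-sided restriction property, is carried in every
Dobrushin domain by simple curves meeting ∂D only at the two marked points (no macroscopic pinching,
no boundary crawling); by LSW03 Prop. 3.3 this is the statement that the restriction exponent of the
limit is exactly 5/8. [deps: NeutralRestriction, DiscrepancyConfCov] [difficulty: open-problem] -/
@[route_item "route-CriticalPhenomena-SAWDeterminantalDiagonal", crux]
def DiscrepancySimple : Prop :=
  let pm : SimpleGraph (Literature.Probability.LatticeModels.Site 2) → Set (Literature.Probability.LatticeModels.Site 2) → ℕ := fun H V => ∏ᶠ C : (H.induce V).ConnectedComponent, max 1 (Nat.card {M : ((H.induce V).induce C.supp).Subgraph // M.IsPerfectMatching}); let m : SimpleGraph (Literature.Probability.LatticeModels.Site 2) → Set (Literature.Probability.LatticeModels.Site 2) → ℝ := fun H S => ∑' p : (Σ x : Literature.Probability.LatticeModels.Site 2, H.Walk x x), if 0 < p.2.length ∧ (∃ v ∈ p.2.support, v ∈ S) then (1 / 4 : ℝ) ^ p.2.length / (p.2.length : ℝ) else 0; let A : Set ℂ → ℝ → Set (Literature.Probability.LatticeModels.Site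 2) := fun Ω δ => {x | ∀ y : Literature.Probability.LatticeModels.Site 2, (∀ i, y i - Int.emod (y i) 2 = x i - Int.emod (x i) 2) → y ∈ Literature.Probability.LatticeModels.meshDomain Ω δ ∧ ∀ z : Literature.Probability.LatticeModels.Site 2, (∀ i, z i - Int.emod (z i) 2 = x i - Int.emod (x i) 2) → (Literature.Probability.LatticeModels.zdGraph 2).Adj y z → (Literature.Probability.LatticeModels.discreteDomainGraph Ω δ).Adj y z}; let L : (Ω : Set ℂ) → (δ : ℝ) → (a b : Literature.Probability.LatticeModels.Site 2) → ℝ → MeasureTheory.Measure (Literature.Probability.RandomPlanarGeometry.SAW.DomainSAW Ω δ a b) := fun Ω δ a b x => let μ : MeasureTheory.Measure (Literature.Probability.RandomPlanarGeometry.SAW.DomainSAW Ω δ a b) := MeasureTheory.Measure.sum (fun γ => ENNReal.ofReal (x ^ γ.length * Real.exp (m (Literature.Probability.LatticeModels.discreteDomainGraph Ω δ) {v | v ∈ γ.walk.support} / 2) * (pm (Literature.Probability.LatticeModels.discreteDomainGraph Ω δ) (A Ω δ \ {v | v ∈ γ.walk.support}) : ℝ) ^ 2) • MeasureTheory.Measure.dirac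 γ); (μ Set.univ)⁻¹ • μ; ∀ x : ℝ, 0 < x → ∀ P : Literature.Probability.RandomPlanarGeometry.ChordalFamily, P.IsChordal → (∀ (D : Literature.Probability.RandomPlanarGeometry.DobrushinDomain) (a b : ℝ → Literature.Probability.LatticeModels.Site 2), Literature.Probability.RandomPlanarGeometry.SAW.IsEndpointApprox D a b → Literature.Probability.RandomPlanarGeometry.TendstoLaw (fun δ (γ : Literature.Probability.RandomPlanarGeometry.SAW.DomainSAW D.carrier δ (a δ) (b δ)) => γ.curve) (fun δ => L D.carrier δ (a δ) (b δ) x) id (P D)) → P.IsConformallyCovariant → P.IsRestriction → ∀ D : Literature.Probability.RandomPlanarGeometry.DobrushinDomain, ∀ᵐ γ ∂(P D), γ ∈ Literature.Probability.RandomPlanarGeometry.CurveClass.simple ∧ γ.range ∩ frontier D.carrier ⊆ {D.pt 0, D.pt 1}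

/-- item stmt-CriticalPhenomena-3017 · support · rank 9 · closed · proved by Summit.CriticalPhenomena.SAWScalingLimit.Theorems.LSWSimpleRestrictionIsSLE_proof @ db6b0749abc7 (prover) · by planner
sources: LawlerSchrammWerner2003Restriction, RohdeSchramm2005, Lawler2005
[support] LSW03 classification in HYPOTHESIS-FREE form (route repair 2026-08-15; implies the shared
item stmt-CriticalPhenomena-0775 = LSWRestrictionFact verbatim, see planner Sketch.lean
`lsw_new_implies_old`): a chordal family on Dobrushin domains that is chordal, conformally covariant
(ChordalFamily.IsConformallyCovariant), has the two-sided restriction property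
(ChordalFamily.IsRestriction) and is carried by simple curves meeting ∂D only at the two marked
points is, in every domain, the chordal SLE_{8/3} law (IsSLELaw (8/3)). The named-fact hypotheses of
stmt-0775 are dropped because they are not needed at κ = 8/3: existence is the library THEOREM
Literature.Probability.RandomPlanarGeometry.exists_isSLECurve_eightThirds (SLEExistenceNeEightHolds;
Rohde–Schramm Thm 5.1 + Thm 7.1; axiom closure propext/choice/Quot.sound checked), uniqueness in law
is IsSLECurve.map_eq_holds (SLEUniquenessInLaw); `exists_isSLECurve` for ALL κ is equivalent to the
unproved SLE₈ trace theorem (hasSLETrace_eight, SLETransienceIffTrace) and must not burden an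
SLE_{8/3} route. Sources: LawlerSchrammWerner2003Restriction (arXiv:math/0209343: p.5 results 1–2,
Prop. 3.3, Thm 6.1, Cor. 8.6), RohdeSchramm20 -/
@[route_item "route-CriticalPhenomena-SAWDeterminantalDiagonal", crux]
def LSWSimpleRestrictionIsSLE : Prop :=
  ∀ P : Literature.Probability.RandomPlanarGeometry.ChordalFamily, P.IsChordal → P.IsConformallyCovariant → P.IsRestriction → (∀ D : Literature.Probability.RandomPlanarGeometry.DobrushinDomain, ∀ᵐ γ ∂(P D), γ ∈ Literature.Probability.RandomPlanarGeometry.CurveClass.simple ∧ γ.range ∩ frontier D.carrier ⊆ {D.pt 0, D.pt 1}) → ∀ D : Literature.Probability.RandomPlanarGeometry.DobrushinDomain, Literature.Probability.RandomPlanarGeometry.IsSLELaw ((8 : NNReal) / 3) D (P D)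

/-- `LSWSimpleRestrictionIsSLE` holds: proved by `Summit.CriticalPhenomena.SAWScalingLimit.Theorems.LSWSimpleRestrictionIsSLE_proof` @ db6b0749abc7. -/
theorem LSWSimpleRestrictionIsSLE_holds : LSWSimpleRestrictionIsSLE := _root_.Summit.CriticalPhenomena.SAWScalingLimit.Theorems.LSWSimpleRestrictionIsSLE_proof

/-- item stmt-CriticalPhenomena-8249 · support · rank 9 · open · by planner
sources: LawlerSchrammWerner2004SAW, LawlerSchrammWerner2003Restriction, BillingsleyCPM1999
[support] glue (passage to the limit): NeutralRestriction implies that every chordal, conformally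
covariant family arising as the weak limit of the discrepancy-walk laws at a fugacity x > 0 has the
restriction property ChordalFamily.IsRestriction — portmanteau on the closed events range ⊆ cl D′,
the null-touching of ∂(D∖D′) obtained from monotonicity in continuously shrinking hull families plus
weak continuity of D′ ↦ P D′ (conformal covariance), and the trivial case P D(range ⊆ cl D′) = 0.
[difficulty: L] -/
@[route_item "route-CriticalPhenomena-SAWDeterminantalDiagonal", crux]
def RestrictionOfDiagLimit : Prop :=
  NeutralRestriction → let pm : SimpleGraph (Literature.Probability.LatticeModels.Site 2) → Set (Literature.Probability.LatticeModels.Site 2) → ℕ := fun H V => ∏ᶠ C : (H.induce V).ConnectedComponent, max 1 (Nat.card {M : ((H.induce V).induce C.supp).Subgraph // M.IsPerfectMatching}); let m : SimpleGraph (Literature.Probability.LatticeModels.Site 2) → Set (Literature.Probability.LatticeModels.Site 2) → ℝ := fun H S => ∑' p : (Σ x : Literature.Probability.LatticeModels.Site 2, H.Walk x x), if 0 < p.2.length ∧ (∃ v ∈ p.2.support, v ∈ S) then (1 / 4 : ℝ) ^ p.2.length / (p.2.length : ℝ) else 0; let A : Set ℂ → ℝ → Set (Literature.Probability.LatticeModels.Site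 2) := fun Ω δ => {x | ∀ y : Literature.Probability.LatticeModels.Site 2, (∀ i, y i - Int.emod (y i) 2 = x i - Int.emod (x i) 2) → y ∈ Literature.Probability.LatticeModels.meshDomain Ω δ ∧ ∀ z : Literature.Probability.LatticeModels.Site 2, (∀ i, z i - Int.emod (z i) 2 = x i - Int.emod (x i) 2) → (Literature.Probability.LatticeModels.zdGraph 2).Adj y z → (Literature.Probability.LatticeModels.discreteDomainGraph Ω δ).Adj y z}; let L : (Ω : Set ℂ) → (δ : ℝ) → (a b : Literature.Probability.LatticeModels.Site 2) → ℝ → MeasureTheory.Measure (Literature.Probability.RandomPlanarGeometry.SAW.DomainSAW Ω δ a b) := fun Ω δ a b x => let μ : MeasureTheory.Measure (Literature.Probability.RandomPlanarGeometry.SAW.DomainSAW Ω δ a b) := MeasureTheory.Measure.sum (fun γ => ENNReal.ofReal (x ^ γ.length * Real.exp (m (Literature.Probability.LatticeModels.discreteDomainGraph Ω δ) {v | v ∈ γ.walk.support} / 2) * (pm (Literature.Probability.LatticeModels.discreteDomainGraph Ω δ) (A Ω δ \ {v | v ∈ γ.walk.support}) : ℝ) ^ 2) • MeasureTheory.Measure.dirac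 γ); (μ Set.univ)⁻¹ • μ; ∀ x : ℝ, 0 < x → ∀ P : Literature.Probability.RandomPlanarGeometry.ChordalFamily, P.IsChordal → (∀ (D : Literature.Probability.RandomPlanarGeometry.DobrushinDomain) (a b : ℝ → Literature.Probability.LatticeModels.Site 2), Literature.Probability.RandomPlanarGeometry.SAW.IsEndpointApprox D a b → Literature.Probability.RandomPlanarGeometry.TendstoLaw (fun δ (γ : Literature.Probability.RandomPlanarGeometry.SAW.DomainSAW D.carrier δ (a δ) (b δ)) => γ.curve) (fun δ => L D.carrier δ (a δ) (b δ) x) id (P D)) → P.IsConformallyCovariant → P.IsRestriction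

/-- item stmt-CriticalPhenomena-8250 · support · rank 9 · open · by planner
sources: CohnKenyonPropp2001, Kenyon2000, HeilmannLieb1972
[support] the discrepancy walk is eventually a probability law: for every x > 0, Dobrushin domain
and endpoint approximation, for all small δ > 0 the normalised law has mass 1 — every weight is
positive (the componentwise dimer factor is ≥ 1, e^(m/2) > 0) and there are finitely many SAWs of
D_δ, at least one by IsEndpointApprox.reachable; the lattice sanity half of (lim) in
DiscrepancyConfCov. [difficulty: provable-now] -/
@[route_item "route-CriticalPhenomena-SAWDeterminantalDiagonal"]
def DiscrepancyNondegenerate : Prop :=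
  let pm : SimpleGraph (Literature.Probability.LatticeModels.Site 2) → Set (Literature.Probability.LatticeModels.Site 2) → ℕ := fun H V => ∏ᶠ C : (H.induce V).ConnectedComponent, max 1 (Nat.card {M : ((H.induce V).induce C.supp).Subgraph // M.IsPerfectMatching}); let m : SimpleGraph (Literature.Probability.LatticeModels.Site 2) → Set (Literature.Probability.LatticeModels.Site 2) → ℝ := fun H S => ∑' p : (Σ x : Literature.Probability.LatticeModels.Site 2, H.Walk x x), if 0 < p.2.length ∧ (∃ v ∈ p.2.support, v ∈ S) then (1 / 4 : ℝ) ^ p.2.length / (p.2.length : ℝ) else 0; let A : Set ℂ → ℝ → Set (Literature.Probability.LatticeModels.Site 2) := fun Ω δ => {x | ∀ y : Literature.Probability.LatticeModels.Site 2, (∀ i, y i - Int.emod (y i) 2 = x i - Int.emod (x i) 2) → y ∈ Literature.Probability.LatticeModels.meshDomain Ω δ ∧ ∀ z : Literature.Probability.LatticeModels.Site 2, (∀ i, z i - Int.emod (z i) 2 = x i - Int.emod (x i) 2) → (Literature.Probability.LatticeModels.zdGraph 2).Adj y z → (Literature.Probability.LatticeModels.discreteDomainGraph Ω δ).Adj y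 z}; let L : (Ω : Set ℂ) → (δ : ℝ) → (a b : Literature.Probability.LatticeModels.Site 2) → ℝ → MeasureTheory.Measure (Literature.Probability.RandomPlanarGeometry.SAW.DomainSAW Ω δ a b) := fun Ω δ a b x => let μ : MeasureTheory.Measure (Literature.Probability.RandomPlanarGeometry.SAW.DomainSAW Ω δ a b) := MeasureTheory.Measure.sum (fun γ => ENNReal.ofReal (x ^ γ.length * Real.exp (m (Literature.Probability.LatticeModels.discreteDomainGraph Ω δ) {v | v ∈ γ.walk.support} / 2) * (pm (Literature.Probability.LatticeModels.discreteDomainGraph Ω δ) (A Ω δ \ {v | v ∈ γ.walk.support}) : ℝ) ^ 2) • MeasureTheory.Measure.dirac γ); (μ Set.univ)⁻¹ • μ; ∀ x : ℝ, 0 < x → ∀ (D : Literature.Probability.RandomPlanarGeometry.DobrushinDomain) (a b : ℝ → Literature.Probability.LatticeModels.Site 2), Literature.Probability.RandomPlanarGeometry.SAW.IsEndpointApprox D a b → ∀ᶠ δ in nhdsWithin 0 (Set.Ioi 0), MeasureTheory.IsProbabilityMeasure (L D.carrier δ (a δ) (b δ) x)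

/-- item stmt-CriticalPhenomena-8251 · support · rank 9 · closed · proved by Summit.CriticalPhenomena.SAWScalingLimit.Theorems.DetDiagAssemblyTarget_proof @ 46c05c195dc9 (prover) · by planner
sources: LawlerSchrammWerner2004SAW
[support] Target → SAWScalingLimit (pure logic: instantiate (U) at the fugacity of (DW);
`assemblyTarget_holds` in Sketch.lean). [difficulty: provable-now] -/
@[route_item "route-CriticalPhenomena-SAWDeterminantalDiagonal"]
def AssemblyTarget : Prop :=
  Target → SAWScalingLimit

-- item stmt-CriticalPhenomena-8350 · support · rank 9 · open · by planner — informal only, no Lean statement yet: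
--   [support] (card D1, provable now; lattice identities behind the two dressings, not used by Assembly)
--   For a finite vertex set V of Z^2 with its domain graph: (i) Lawler/Jacobi: exp(m_V(S)) = det((I -
--   P_V)^(-1) restricted to S x S) = det(I - P_(V minus S))/det(I - P_V) for every S subset of V, P_V
--   the simple-random-walk kernel killed off V (Lawler2018 Prop 5.2, KozdronLawler2007 sec. 6); hence
--   the discrepancy-walk factor e^(m(gamma)/2) = 2^(|gamma|+1) (det Delta_(V minus gamma)/det
--   Delta_V)^(1/2), Delta = Dirichlet graph Laplacian 4I - A. (ii) Kasteleyn x Jacobi x Heilmann-Lieb: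
--   for a balanced s

/-- item stmt-CriticalPhenomena-14274 · support · rank 10 · closed · proved by Summit.CriticalPhenomena.SAWScalingLimit.Theorems.DetDiagTargetFromCruxes_proof @ 46c05c195dc9 (prover) · by planner
sources: LawlerSchrammWerner2003Restriction, LawlerSchrammWerner2004SAW
[support] glue cruxes → Target (route-choice repair 2026-08-16, option (a)): Target (#0) was
unreachable — the deciding theorem `closes` and `Assembly` run cruxes → SAWScalingLimit,
`AssemblyTarget` runs Target → SAWScalingLimit, and no item concluded Target. Statement: the route's
four cruxes (rank order #2 NeutralRestriction, #3 DiscrepancyConfCov, #4 DiagonalUniversality, #5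
DiscrepancySimple) together with the two rank-9 supports LSWSimpleRestrictionIsSLE and
RestrictionOfDiagLimit imply Target = (DW) ∧ (U). Proof (pure logic, PROVED sorry-free in planner
Sketch.lean as `targetFromCruxes_holds`, axioms propext/Classical.choice/Quot.sound — the term of
`closes` with `refine ⟨_, hDU⟩` in front): (U) is DiagonalUniversality verbatim (identical inlined
lets, closes by `exact`); (DW) at the fugacity x produced by DiscrepancyConfCov:
RestrictionOfDiagLimit fed with NeutralRestriction gives P.IsRestriction, DiscrepancySimple the
simple-curve clause, LSWSimpleRestrictionIsSLE gives IsSLELaw (8/3) D (P D), i.e. P D =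
preWienerMeasure.map Γ for an SLE_8/3 curve Γ; MeasureTheory.integral_map converts TendstoLaw … id
(P D) into TendstoLaw … Γ preWienerMeasure and AEMeasurability on SAW.Dom -/
@[route_item "route-CriticalPhenomena-SAWDeterminantalDiagonal"]
def TargetFromCruxes : Prop :=
  NeutralRestriction → DiscrepancyConfCov → DiagonalUniversality → DiscrepancySimple → LSWSimpleRestrictionIsSLE → RestrictionOfDiagLimit → Target

/-- item stmt-CriticalPhenomena-8252 · assembly · rank 1 · closed · proved by Summit.CriticalPhenomena.SAWScalingLimit.Theorems.DetDiagAssembly_proof @ 625de6d8e746 (prover) · by planner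
sources: LawlerSchrammWerner2003Restriction, LawlerSchrammWerner2004SAW, KozdronLawler2007
[assembly] LSWSimpleRestrictionIsSLE → NeutralRestriction → RestrictionOfDiagLimit →
DiscrepancyConfCov → DiscrepancySimple → DiagonalUniversality → SAWScalingLimit. -/
@[route_item "route-CriticalPhenomena-SAWDeterminantalDiagonal"]
def Assembly : Prop :=
  LSWSimpleRestrictionIsSLE → NeutralRestriction → RestrictionOfDiagLimit → DiscrepancyConfCov → DiscrepancySimple → DiagonalUniversality → SAWScalingLimit

/-! D-0027 §2.1 — DECIDING THEOREM (planner-authored via `route open/edit --closes-file`; by planner-rbadge-CriticalPhenomena-SAWDeterminan-921f123a-g4-0 2026-08-15T16:12:47Z):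
its hypotheses are this route's items and its conclusion the sub-problem Statement (glue_lint), and it elaborates with this file. -/

@[closes "route-CriticalPhenomena-SAWDeterminantalDiagonal"] theorem closes (hLSW : LSWSimpleRestrictionIsSLE) (hNR : NeutralRestriction)
    (hRes : RestrictionOfDiagLimit) (hCC : DiscrepancyConfCov) (hSimple : DiscrepancySimple)
    (hDU : DiagonalUniversality) : _root_.SAWScalingLimit := by
  obtain ⟨x, hx, P, hPch, hlim, hcov⟩ := hCC
  have hres : P.IsRestriction := hRes hNR x hx P hPch hlim hcov
  have hsimple := hSimple x hx P hPch hlim hcov hres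
  have hsle : ∀ D : Literature.Probability.RandomPlanarGeometry.DobrushinDomain,
      Literature.Probability.RandomPlanarGeometry.IsSLELaw ((8 : NNReal) / 3) D (P D) :=
    hLSW P hPch hcov hres hsimple
  refine hDU x hx ?_
  intro D a b hab
  obtain ⟨Γ, hΓ, hPD⟩ := hsle D
  refine ⟨Γ, hΓ, Filter.Eventually.of_forall fun δ =>
    (Literature.Probability.RandomPlanarGeometry.SAW.DomainSAW.measurable_of_top _).aemeasurable,
    fun f => ?_⟩
  have h := hlim D a b hab f
  have e : (∫ ω, f (id ω) ∂(P D)) =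
      ∫ ω, f (Γ ω) ∂Literature.Probability.Process.preWienerMeasure := (by
    rw [hPD]
    exact MeasureTheory.integral_map hΓ.aemeasurable f.continuous.aestronglyMeasurable)
  rw [e] at h
  exact h

end Summit.CriticalPhenomena.SAWScalingLimit.Theses.SAWDeterminantalDiagonal
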